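import Summits.HodgeConjecture.CorCM.Census.DicyclicTwistDescent
import Summits.HodgeConjecture.CorCM.Census.QuarticInversionMotion

/-!
# The quartic inversion twists, V: the potential and the halves

COR-CM (cell `pub-hodgecm2`, stage 2 of the Hodge ladder), count-neutral KERNEL COMBINATORICS by the binder seat b23 (gen 44; claim
QUARTIC-INVERSION, HOME/INBOX.md l.12829).  Part V of the lane `Census/QuarticInversion*`, on top of parts I–IV and the dicyclic lane's part III
(`Census/DicyclicTwistDescent.lean`: `clsTy_rev`, `wt_rev`) and seat b09's slice (`clsTy`, `clsTy_tw`, `wt`, `wt_add_one`), all BY NAME.  Bookkeeping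
definitions with bodies (`pot₄`, `half`) + theorems; no `Prop`-valued definition, no `decide` table, no certificate, no named fact, no `sorry`.
`Interfaces.lean` (C1), every E term, B01, `Transposition/*`, `PortJoin/*` untouched.
HONEST FRAMING: `HC_CM` is NOT proved, here or anywhere in the tree; nothing here is a period, a count of record or a headline.

CONTENT.  **The potential** `pot₄ Θ = Σ_k cls(coord k Θ)` (`cls ψ = min(wt ψ, |B| − wt ψ)`, b09's defect class) is invariant under the three motions
and under conjugation (`pot₄_twH₄`, `pot₄_twY`, `pot₄_twT`, `pot₄_conj₄`), changes under a flip only through the flipped coordinate (`pot₄_addAt`), and is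
at most `4|B|`; a label is RESIDUAL iff `pot₄ ≤ 1` (all four coordinates constant, or one atom).  **The half** `half ψ ∈ Bool` of a slice label
(`wt ψ ≤ |B|/2`) is kept by translations and reversal and FLIPPED by complementation when `|B|` is odd (`half_add_one`), so every motion maps equal
halves to equal halves (`half_tw_eq_iff`, `half_add_cst_eq_iff`, `half_add_one_eq_iff`).  Part VI (`…Descent`) builds the reducing faces and the descent
on these.  All [folklore].

## References
* [Pohlmann1968] H. Pohlmann, Algebraic cycles on abelian varieties of complex multiplication type, Ann. of Math. 88 (1968), Thm 1.
-/

namespace Summit.HodgeConjecture.CorCM.Census.QuarticInversion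

open Finset
open Summit.HodgeConjecture.CorCM.Census.OddSliceFacesModel
open Summit.HodgeConjecture.CorCM.Census.OddSliceFacesSquares (clsTy clsTy_tw)
open Summit.HodgeConjecture.CorCM.Census.DicyclicTwist (Ty₂ rev twH clsTy_rev)
open Summit.HodgeConjecture.CorCM.Census.EvenSliceFacesDescent (clsTy_add_one)

noncomputable section

/-! ## §1 The potential and the halves -/

section Potential

variable (A : Type) [AddCommGroup A] [Fintype A] [DecidableEq A]

/-- **The potential** of a quadruple: the sum of the defect classes of its four coordinates. [folklore] -/
def pot₄ (Θ : Ty₄ A) : ℕ := clsTy A Θ.1.1 + clsTy A Θ.1.2 + clsTy A Θ.2.1 + clsTy A Θ.2.2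

omit [AddCommGroup A] [DecidableEq A] in
/-- The potential as a sum over the four coordinates. [folklore] -/
theorem pot₄_eq_sum (Θ : Ty₄ A) : pot₄ A Θ = ∑ k : Fin 4, clsTy A (coord A k Θ) := by
  rw [Fin.sum_univ_four]; rfl

omit [DecidableEq A] in
/-- The potential is invariant under conjugation. [folklore] -/
theorem pot₄_conj₄ (Θ : Ty₄ A) : pot₄ A (conj₄ A Θ) = pot₄ A Θ := by
  obtain ⟨⟨ψ₀, ψ₁⟩, ⟨ψ₂, ψ₃⟩⟩ := Θ
  show clsTy A (ψ₀ + 1) + clsTy A (ψ₁ + 1) + clsTy A (ψ₂ + 1) + clsTy A (ψ₃ + 1) = clsTy A ψ₀ + clsTy A ψ₁ + clsTy A ψ₂ + clsTy A ψ₃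
  rw [clsTy_add_one, clsTy_add_one, clsTy_add_one, clsTy_add_one]

omit [DecidableEq A] in
/-- The potential is invariant under the diagonal motions. [folklore] -/
theorem pot₄_twH₄ (g : ZMod 2 × A) (Θ : Ty₄ A) : pot₄ A (twH₄ A g Θ) = pot₄ A Θ := by
  simp only [pot₄_eq_sum, coord_twH₄, clsTy_tw]

omit [DecidableEq A] in
/-- The class of a constant-shifted label. [folklore] -/
theorem clsTy_add_cst (ψ : Ty A) (ζ : ZMod 2) : clsTy A (ψ + cst A ζ) = clsTy A ψ := by
  have h01 : ∀ u : ZMod 2, u = 0 ∨ u = 1 := by decide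
  rcases h01 ζ with rfl | rfl
  · rw [cst_zero, add_zero]
  · rw [cst_one, clsTy_add_one]

omit [DecidableEq A] in
/-- The potential is invariant under the motion of `y`. [folklore] -/
theorem pot₄_twY (ζ : ZMod 2) (Θ : Ty₄ A) : pot₄ A (twY A ζ Θ) = pot₄ A Θ := by
  obtain ⟨⟨ψ₀, ψ₁⟩, ⟨ψ₂, ψ₃⟩⟩ := Θ
  show clsTy A (rev A ψ₁) + clsTy A (rev A ψ₀ + cst A ζ) + clsTy A (rev A ψ₃) + clsTy A (rev A ψ₂ + cst A ζ) =
    clsTy A ψ₀ + clsTy A ψ₁ + clsTy A ψ₂ + clsTy A ψ₃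
  rw [clsTy_add_cst, clsTy_add_cst, clsTy_rev, clsTy_rev, clsTy_rev, clsTy_rev]
  ring

omit [DecidableEq A] in
/-- The potential is invariant under the motion of `t`. [folklore] -/
theorem pot₄_twT (Θ : Ty₄ A) : pot₄ A (twT A Θ) = pot₄ A Θ := by
  obtain ⟨⟨ψ₀, ψ₁⟩, ⟨ψ₂, ψ₃⟩⟩ := Θ
  show clsTy A ψ₂ + clsTy A (ψ₃ + 1) + clsTy A (ψ₀ + 1) + clsTy A ψ₁ = clsTy A ψ₀ + clsTy A ψ₁ + clsTy A ψ₂ + clsTy A ψ₃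
  rw [clsTy_add_one, clsTy_add_one]
  ring

omit [AddCommGroup A] [DecidableEq A] in
/-- **Potential of a flipped label**: only the flipped coordinate changes. [folklore] -/
theorem pot₄_addAt (k : Fin 4) (χ : Ty A) (Θ : Ty₄ A) :
    pot₄ A (addAt A k χ Θ) + clsTy A (coord A k Θ) = pot₄ A Θ + clsTy A (coord A k Θ + χ) := by
  obtain ⟨⟨ψ₀, ψ₁⟩, ⟨ψ₂, ψ₃⟩⟩ := Θ
  fin_cases k <;> simp [pot₄, addAt, coord] <;> ring

omit [AddCommGroup A] [DecidableEq A] in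
/-- The potential is bounded by `4|B|`. [folklore] -/
theorem pot₄_le (Θ : Ty₄ A) : pot₄ A Θ ≤ 4 * Fintype.card A := by
  unfold pot₄ clsTy
  have h0 := wt_le A Θ.1.1; have h1 := wt_le A Θ.1.2; have h2 := wt_le A Θ.2.1; have h3 := wt_le A Θ.2.2
  omega

omit [AddCommGroup A] [DecidableEq A] in
/-- **The half** of a slice label: `true` for the lower half `wt ≤ |B|/2` (for `|B|` odd: strictly below the equator). [folklore] -/
def half (ψ : Ty A) : Bool := decide (wt A ψ ≤ Fintype.card A / 2)

omit [AddCommGroup A] [DecidableEq A] in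
/-- `half ψ = half ψ'` iff the two weights lie on the same side. [folklore] -/
theorem half_eq_half_iff (ψ ψ' : Ty A) : half A ψ = half A ψ' ↔ (wt A ψ ≤ Fintype.card A / 2 ↔ wt A ψ' ≤ Fintype.card A / 2) := by
  unfold half
  by_cases h : wt A ψ ≤ Fintype.card A / 2 <;> by_cases h' : wt A ψ' ≤ Fintype.card A / 2 <;> simp [h, h']

omit [DecidableEq A] in
/-- Translation by `(0, s)` preserves the half. [folklore] -/
theorem half_tw_zero (s : A) (ψ : Ty A) : half A (tw A (0, s) ψ) = half A ψ := by
  unfold half; rw [wt_tw_zero]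

omit [AddCommGroup A] [DecidableEq A] in
/-- For `|B|` odd, complementation flips the half. [folklore] -/
theorem half_add_one (hA : Odd (Fintype.card A)) (ψ : Ty A) : half A (ψ + 1) = !half A ψ := by
  unfold half
  rw [wt_add_one]
  have hw := wt_le A ψ
  obtain ⟨j, hj⟩ := hA
  by_cases h : wt A ψ ≤ Fintype.card A / 2 <;> simp [h] <;> omega

omit [DecidableEq A] in
/-- Hence for `|B|` odd every twist maps equal halves to equal halves. [folklore] -/
theorem half_tw_eq_iff (hA : Odd (Fintype.card A)) (g : ZMod 2 × A) (ψ ψ' : Ty A) :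
    half A (tw A g ψ) = half A (tw A g ψ') ↔ half A ψ = half A ψ' := by
  obtain ⟨e, s⟩ := g
  have h01 : ∀ u : ZMod 2, u = 0 ∨ u = 1 := by decide
  rcases h01 e with rfl | rfl
  · rw [half_tw_zero, half_tw_zero]
  · rw [tw_one, tw_one, half_add_one A hA, half_add_one A hA, half_tw_zero, half_tw_zero]
    cases half A ψ <;> cases half A ψ' <;> simp

omit [DecidableEq A] in
/-- Reversal preserves the half. [folklore] -/
theorem half_rev (ψ : Ty A) : half A (rev A ψ) = half A ψ := by
  unfold half; rw [Summit.HodgeConjecture.CorCM.Census.DicyclicTwist.wt_rev]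

omit [AddCommGroup A] [DecidableEq A] in
/-- A constant shift maps equal halves to equal halves (`|B|` odd). [folklore] -/
theorem half_add_cst_eq_iff (hA : Odd (Fintype.card A)) (ζ : ZMod 2) (ψ ψ' : Ty A) :
    half A (ψ + cst A ζ) = half A (ψ' + cst A ζ) ↔ half A ψ = half A ψ' := by
  have h01 : ∀ u : ZMod 2, u = 0 ∨ u = 1 := by decide
  rcases h01 ζ with rfl | rfl
  · rw [cst_zero, add_zero, add_zero]
  · rw [cst_one, half_add_one A hA, half_add_one A hA]
    cases half A ψ <;> cases half A ψ' <;> simp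

omit [AddCommGroup A] [DecidableEq A] in
/-- Complementation maps equal halves to equal halves (`|B|` odd). [folklore] -/
theorem half_add_one_eq_iff (hA : Odd (Fintype.card A)) (ψ ψ' : Ty A) : half A (ψ + 1) = half A (ψ' + 1) ↔ half A ψ = half A ψ' := by
  rw [half_add_one A hA, half_add_one A hA]
  cases half A ψ <;> cases half A ψ' <;> simp

end Potential

end

end Summit.HodgeConjecture.CorCM.Census.QuarticInversion
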